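import Summits.Ventures.Crystal3D.Theorems.StickyWulffConstantCoaxialWallLawEndRowOuterShellDefs
import Summits.Ventures.Crystal3D.Theorems.StickyWulffConstantCoaxialWallLawEndRowTail
import HarnessLib

/-!
# The OUTER-SHELL REDUCTION of the (A) census summand (census-free)

HONEST FRAMING. Venture `Summits/Ventures/Crystal3D` (cell `crystal3d-full`), helper `--supports` the crux
`CoaxialWallLaw` (stmt-Ventures-19481, `route-Ventures-StickyWulffConstant`), REGISTERED line `WallLedgerF`, open stub
`stub_coaxialTwoSlabAdhesion`.  Rung credit only; F-C1 not moved.  19481-p1 g13 (TAIL AUDIT, 2026-08-28): the typed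
TAIL `EndRowTransTailA / EndRowTwinTailA v2 (9/2) (barlowWindowUniverse 4)` (`…EndRowOnSiteDefsA`) contains windows
with two irrelevant outer vacancies at the census maximum `1783/420`; this file proves the census-free lemma that
removes the OUTER SHELL `2 < dist z x ≤ 3` from the problem.

THE THEOREM (`localSummandA_le_localSummandFlat`).  Let `X ⊆ X'` be finite configurations that AGREE inside the closed
ball `B̄(z, 2)` about a payer `z ∈ X` (`deg_X z ≤ 11`), and suppose the added balls `X' ∖ X` avoid the three far slots
of every twin reading of `X` at a ball within `2` of `z` (on Barlow sites automatic: the far slots of a live twin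
reading are never sites).  Then for any two plate systems with slot roots
`localSummandA v S₁ S₂ X z ≤ localSummandFlat v S₁ S₂ X' z`
(`…EndRowOuterShellDefs`: two-payer clause dropped from the multiplicity, `pooledDef + [¬ HasTwoPayers]`).  Union form:
`localSummandA_le_localSummandFlat_union` (`X' = X ∪ A`, `A` beyond distance `2` and off the far slots).
MECHANISM (elementary; no census, no kissing facts): at an end ball `b` (`dist z b ≤ 1`) every reading and the
MOVING predicate read `B̄(b, 1) ⊆ B̄(z, 2)` only; at a reader `q` (`dist z q ≤ 2`) FULL / NARROW / clause (A) are
presence-monotone and a twin reading survives when its far slots stay empty; so `endMultA X b ≤ endMultFlat X' b`; the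
payers pooled at `b` lie in `B̄(z, 2)` and their degrees only grow, and an activation of the two-payer clause exhibits a
neighbour of `b` deficient in `X` and saturated in `X'`, worth one unit; termwise `e/p ≤ e♭/p♭`.
USE.  With `X' := (X ∩ B̄(z,2)) ∪ (outer SITES)` a certificate over INNER vacancy patterns evaluated with the flat summand
bounds the typed summand of every window with that inner pattern (numerically the flat summand equals the summand on
every census anchor: `1783/420`, `293/70`, `16/5`, …; 19481-p1 g13 calc/sflat.py).
WHAT THIS IS NOT: not the certificate, not the inner tail, not the Barlow discharge of the far-slot hypothesis (two
lattice facts: basal continuation letter ≠ mirror letter; inclined mirror offsets are off-layer — the frame lemma file's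
business); F-C1 not moved.
-/

noncomputable section

namespace Summit.Ventures.Crystal3D.Theorems

open Summit.Ventures.Crystal3D Finset
open scoped InnerProductSpace

section Basic

variable {X X' : Finset (EuclideanSpace ℝ (Fin 3))} {z : EuclideanSpace ℝ (Fin 3)}

/-- The mirror image of a unit vector across a plane with unit normal is a unit vector. -/
theorem norm_sub_two_inner_smul_eq_one {d m : EuclideanSpace ℝ (Fin 3)} (hd : ‖d‖ = 1) (hm : ‖m‖ = 1) :
    ‖d - (2 * ⟪d, m⟫_ℝ) • m‖ = 1 := by
  have hsq : ‖d - (2 * ⟪d, m⟫_ℝ) • m‖ ^ 2 = 1 := by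
    rw [@norm_sub_sq_real, norm_smul, hm, mul_one, inner_smul_right, hd, Real.norm_eq_abs, sq_abs]
    ring
  have h0 : 0 ≤ ‖d - (2 * ⟪d, m⟫_ℝ) • m‖ := norm_nonneg _
  nlinarith [hsq, h0]

/-- An admissible class direction of a plate system with slot roots is a unit vector. -/
theorem norm_eq_one_of_adm {S : PlateSystem} (hS : S.RT ⊆ fccSlots) {G : EuclideanSpace ℝ (Fin 3) ≃ₗᵢ[ℝ] EuclideanSpace ℝ (Fin 3)}
    {d : EuclideanSpace ℝ (Fin 3)} (h : S.Adm G d) : ‖d‖ = 1 := by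
  obtain ⟨r, hr, κ, -, -, hd⟩ := h
  rw [hd, LinearIsometryEquiv.norm_map, norm_smul, norm_pow, norm_neg, norm_one, one_pow, one_mul]
  exact norm_eq_one_of_mem_fccSlots (hS hr)

/-- A point at distance `≤ 1` from a ball within `1` of `z` is within `2` of `z` (unit-step form). -/
theorem dist_add_le_two {b u : EuclideanSpace ℝ (Fin 3)} (hb : dist z b ≤ 1) (hu : ‖u‖ = 1) :
    dist z (b + u) ≤ 2 := by
  have h : dist b (b + u) = ‖u‖ := by rw [dist_comm, dist_eq_norm, add_sub_cancel_left]
  calc dist z (b + u) ≤ dist z b + dist b (b + u) := dist_triangle _ _ _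
    _ ≤ 2 := by rw [h, hu]; linarith

end Basic
section Transfer

variable {X X' : Finset (EuclideanSpace ℝ (Fin 3))} {z : EuclideanSpace ℝ (Fin 3)}
  (hsub : X ⊆ X') (hin : ∀ x ∈ X', dist z x ≤ 2 → x ∈ X)
include hsub hin

/-- Inside `B̄(z, 2)` the two configurations agree. -/
theorem mem_iff_of_dist_le_two {x : EuclideanSpace ℝ (Fin 3)} (hx : dist z x ≤ 2) : x ∈ X ↔ x ∈ X' :=
  ⟨fun h => hsub h, fun h => hin x h hx⟩

omit hin in
/-- Degrees only grow when the outer shell is filled: for any `y`, `deg_X y ≤ deg_X' y`. -/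
theorem card_contacts_le (y : EuclideanSpace ℝ (Fin 3)) :
    (X.filter fun q => dist y q = 1).card ≤ (X'.filter fun q => dist y q = 1).card :=
  card_le_card (filter_subset_filter _ hsub)

/-- The degree of a ball within `1` of `z` is unchanged. -/
theorem card_contacts_eq {b : EuclideanSpace ℝ (Fin 3)} (hb : dist z b ≤ 1) :
    (X.filter fun q => dist b q = 1).card = (X'.filter fun q => dist b q = 1).card := by
  congr 1
  ext q
  simp only [mem_filter]
  constructor
  · exact fun h => ⟨hsub h.1, h.2⟩
  · rintro ⟨hq, hd⟩
    refine ⟨hin q hq ?_, hd⟩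
    calc dist z q ≤ dist z b + dist b q := dist_triangle _ _ _
      _ ≤ 2 := by rw [hd]; linarith

/-- FULL readings at a ball within `1` of `z` are the same in `X` and `X'`. -/
theorem isFull_iff {b : EuclideanSpace ℝ (Fin 3)} (hb : dist z b ≤ 1)
    (G : EuclideanSpace ℝ (Fin 3) ≃ₗᵢ[ℝ] EuclideanSpace ℝ (Fin 3)) : IsFull X G b ↔ IsFull X' G b := by
  unfold IsFull
  refine forall₂_congr fun w hw => ?_
  exact mem_iff_of_dist_le_two hsub hin
    (dist_add_le_two hb (by rw [LinearIsometryEquiv.norm_map]; exact norm_eq_one_of_mem_fccSlots hw))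

/-- TWIN-DOZEN readings at a ball within `1` of `z` are the same in `X` and `X'`. -/
theorem isTwinReading_iff {b : EuclideanSpace ℝ (Fin 3)} (hb : dist z b ≤ 1)
    (G : EuclideanSpace ℝ (Fin 3) ≃ₗᵢ[ℝ] EuclideanSpace ℝ (Fin 3)) (m : EuclideanSpace ℝ (Fin 3)) :
    IsTwinReading X G m b ↔ IsTwinReading X' G m b := by
  unfold IsTwinReading
  constructor
  · rintro ⟨hmn, hlo, hmi, hfa⟩
    refine ⟨hmn, fun w hw h => hsub (hlo w hw h), fun w hw h => hsub (hmi w hw h), fun w hw h hx => ?_⟩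
    have hGw : ‖G w‖ = 1 := by rw [LinearIsometryEquiv.norm_map]; exact norm_eq_one_of_mem_fccSlots hw
    exact hfa w hw h (hin _ hx (dist_add_le_two hb hGw))
  · rintro ⟨hmn, hlo, hmi, hfa⟩
    have hGw : ∀ w ∈ fccSlots, ‖G w‖ = 1 := fun w hw => by
      rw [LinearIsometryEquiv.norm_map]; exact norm_eq_one_of_mem_fccSlots hw
    exact ⟨hmn, fun w hw h => hin _ (hlo w hw h) (dist_add_le_two hb (hGw w hw)),
      fun w hw h => hin _ (hmi w hw h) (dist_add_le_two hb (norm_sub_two_inner_smul_eq_one (hGw w hw) hmn.1)),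
      fun w hw h hx => hfa w hw h (hsub hx)⟩

/-- NARROW readings at a ball within `1` of `z`, in a unit direction, are the same in `X` and `X'`. -/
theorem isNarrow_iff {b d : EuclideanSpace ℝ (Fin 3)} (hb : dist z b ≤ 1) (hd : ‖d‖ = 1)
    (G : EuclideanSpace ℝ (Fin 3) ≃ₗᵢ[ℝ] EuclideanSpace ℝ (Fin 3)) : IsNarrow X G d b ↔ IsNarrow X' G d b := by
  unfold IsNarrow
  refine and_congr (mem_iff_of_dist_le_two hsub hin (dist_add_le_two hb hd)) ?_
  refine exists_congr fun m => and_congr_right fun _ => and_congr_right fun _ => ?_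
  refine forall₂_congr fun w hw => ?_
  refine imp_congr_right fun _ => ?_
  exact mem_iff_of_dist_le_two hsub hin
    (dist_add_le_two hb (by rw [LinearIsometryEquiv.norm_map]; exact norm_eq_one_of_mem_fccSlots hw))

/-- The MOVING predicate at a ball within `1` of `z`, in a unit direction, is the same in `X` and `X'`. -/
theorem isMoving_iff {b d : EuclideanSpace ℝ (Fin 3)} (hb : dist z b ≤ 1) (hd : ‖d‖ = 1) (v : WordVersion)
    (G : EuclideanSpace ℝ (Fin 3) ≃ₗᵢ[ℝ] EuclideanSpace ℝ (Fin 3)) : IsMoving X v G d b ↔ IsMoving X' v G d b := by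
  unfold IsMoving
  refine or_congr (isFull_iff hsub hin hb G) (or_congr ?_ ?_)
  · exact exists_congr fun m => and_congr_left fun _ => isTwinReading_iff hsub hin hb G m
  · exact and_congr_right fun _ => isNarrow_iff hsub hin hb hd G

omit hin in
/-- FULL readings are monotone under enlarging the configuration. -/
theorem isFull_mono {q : EuclideanSpace ℝ (Fin 3)} {G : EuclideanSpace ℝ (Fin 3) ≃ₗᵢ[ℝ] EuclideanSpace ℝ (Fin 3)}
    (h : IsFull X G q) : IsFull X' G q :=
  fun w hw => hsub (h w hw)

omit hin in
/-- NARROW readings are monotone under enlarging the configuration. -/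
theorem isNarrow_mono {q d : EuclideanSpace ℝ (Fin 3)} {G : EuclideanSpace ℝ (Fin 3) ≃ₗᵢ[ℝ] EuclideanSpace ℝ (Fin 3)}
    (h : IsNarrow X G d q) : IsNarrow X' G d q := by
  obtain ⟨hqd, m, hmn, hdm, htr⟩ := h
  exact ⟨hsub hqd, m, hmn, hdm, fun w hw hp => hsub (htr w hw hp)⟩

omit hin in
/-- TWIN-DOZEN readings survive the enlargement when the added balls avoid the three far slots. -/
theorem isTwinReading_mono {q : EuclideanSpace ℝ (Fin 3)} {G : EuclideanSpace ℝ (Fin 3) ≃ₗᵢ[ℝ] EuclideanSpace ℝ (Fin 3)}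
    {m : EuclideanSpace ℝ (Fin 3)} (h : IsTwinReading X G m q)
    (hfar : ∀ w ∈ fccSlots, 0 < ⟪G w, m⟫_ℝ → q + G w ∉ X') : IsTwinReading X' G m q := by
  obtain ⟨hmn, hlo, hmi, -⟩ := h
  exact ⟨hmn, fun w hw h => hsub (hlo w hw h), fun w hw h => hsub (hmi w hw h), hfar⟩

/-- END MOVES onto a ball within `1` of `z` survive the enlargement (reader `q`, unit direction `d`), provided the
added balls avoid the far slots of `q`'s twin readings. -/
theorem isEndMove_mono {q b d : EuclideanSpace ℝ (Fin 3)} (hb : dist z b ≤ 1) (hd : ‖d‖ = 1) {v : WordVersion}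
    {G : EuclideanSpace ℝ (Fin 3) ≃ₗᵢ[ℝ] EuclideanSpace ℝ (Fin 3)}
    (hfar : ∀ m, IsTwinReading X G m q → ∀ w ∈ fccSlots, 0 < ⟪G w, m⟫_ℝ → q + G w ∉ X')
    (h : IsEndMove X v G d q b) : IsEndMove X' v G d q b := by
  unfold IsEndMove at h ⊢
  rcases h with ⟨hread, hbq, hnm⟩ | ⟨m, htw, hdm, hbq, hnm⟩
  · refine Or.inl ⟨?_, hbq, fun hm => hnm ((isMoving_iff hsub hin hb hd v G).2 hm)⟩
    rcases hread with hf | ⟨hv, hn⟩ | ⟨m, htw, hdm⟩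
    · exact Or.inl (isFull_mono hsub hf)
    · exact Or.inr (Or.inl ⟨hv, isNarrow_mono hsub hn⟩)
    · exact Or.inr (Or.inr ⟨m, isTwinReading_mono hsub htw (hfar m htw), hdm⟩)
  · refine Or.inr ⟨m, isTwinReading_mono hsub htw (hfar m htw), hdm, hbq, fun hm => hnm ?_⟩
    have hm1 : ‖m‖ = 1 := htw.1.1
    have hbq1 : ‖b - q‖ = 1 := by
      rw [hbq, show q - (d - (2 * ⟪d, m⟫_ℝ) • m) - q = -(d - (2 * ⟪d, m⟫_ℝ) • m) by abel, norm_neg]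
      exact norm_sub_two_inner_smul_eq_one hd hm1
    exact (isMoving_iff hsub hin hb hbq1 v _).2 hm

end Transfer
section Reduction

variable {X X' : Finset (EuclideanSpace ℝ (Fin 3))} {z : EuclideanSpace ℝ (Fin 3)} {v : WordVersion}
  {S₁ S₂ : PlateSystem}

/-- **End pairs transfer**: an (A)-end pair `(b, q)` of `X` with `b` within `1` of `z` is a flat end pair of `X'`. -/
theorem isEndPairFlat_of_isEndPairA_outer (h₁ : S₁.RT ⊆ fccSlots) (h₂ : S₂.RT ⊆ fccSlots) (hsub : X ⊆ X')
    (hin : ∀ x ∈ X', dist z x ≤ 2 → x ∈ X)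
    (hfar : ∀ q ∈ X, dist z q ≤ 2 → ∀ (G : EuclideanSpace ℝ (Fin 3) ≃ₗᵢ[ℝ] EuclideanSpace ℝ (Fin 3)) (m),
      IsTwinReading X G m q → ∀ w ∈ fccSlots, 0 < ⟪G w, m⟫_ℝ → q + G w ∉ X')
    {b q : EuclideanSpace ℝ (Fin 3)} (hb : dist z b ≤ 1) (h : IsEndPairA X v S₁ S₂ b q) :
    IsEndPairFlat X' v S₁ S₂ b q := by
  have hbq : dist b q = 1 := dist_eq_one_of_isEndPair h₁ h₂ (isEndPair_of_isEndPairA h)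
  obtain ⟨hq, hbX, -, G, d, hadm, hpred, hmove⟩ := h
  have hd : ‖d‖ = 1 := by
    rcases hadm with ha | ha
    · exact norm_eq_one_of_adm h₁ ha
    · exact norm_eq_one_of_adm h₂ ha
  have hzq : dist z q ≤ 2 := by
    calc dist z q ≤ dist z b + dist b q := dist_triangle _ _ _
      _ ≤ 2 := by rw [hbq]; linarith
  exact ⟨hsub hq, hsub hbX, G, d, hadm, hsub hpred,
    isEndMove_mono hsub hin hb hd (fun m htw => hfar q hq hzq G m htw) hmove⟩

open scoped Classical in
/-- **Multiplicities**: `endMultA X ≤ endMultFlat X'` at every ball within `1` of `z`. -/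
theorem endMultA_le_endMultFlat (h₁ : S₁.RT ⊆ fccSlots) (h₂ : S₂.RT ⊆ fccSlots) (hsub : X ⊆ X')
    (hin : ∀ x ∈ X', dist z x ≤ 2 → x ∈ X)
    (hfar : ∀ q ∈ X, dist z q ≤ 2 → ∀ (G : EuclideanSpace ℝ (Fin 3) ≃ₗᵢ[ℝ] EuclideanSpace ℝ (Fin 3)) (m),
      IsTwinReading X G m q → ∀ w ∈ fccSlots, 0 < ⟪G w, m⟫_ℝ → q + G w ∉ X')
    {b : EuclideanSpace ℝ (Fin 3)} (hb : dist z b ≤ 1) :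
    endMultA X v S₁ S₂ b ≤ endMultFlat X' v S₁ S₂ b := by
  unfold endMultA endMultFlat
  refine card_le_card fun q hq => ?_
  rw [mem_filter] at hq ⊢
  exact ⟨hsub hq.1, isEndPairFlat_of_isEndPairA_outer h₁ h₂ hsub hin hfar hb hq.2⟩

open scoped Classical in
/-- **Pooled deficiency, no activation**: `pooledDef X' b ≤ pooledDef X b` for `b` within `1` of `z`. -/
theorem pooledDef_le_of_outer (hsub : X ⊆ X') (hin : ∀ x ∈ X', dist z x ≤ 2 → x ∈ X)
    {b : EuclideanSpace ℝ (Fin 3)} (hb : dist z b ≤ 1) : pooledDef X' b ≤ pooledDef X b := by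
  unfold pooledDef
  set P := X.filter (fun y => dist b y ≤ 1 ∧ (X.filter fun q => dist y q = 1).card ≤ 11) with hP
  set P' := X'.filter (fun y => dist b y ≤ 1 ∧ (X'.filter fun q => dist y q = 1).card ≤ 11) with hP'
  have hPP : P' ⊆ P := by
    intro y hy
    rw [hP', mem_filter] at hy
    rw [hP, mem_filter]
    have hzy : dist z y ≤ 2 := by
      calc dist z y ≤ dist z b + dist b y := dist_triangle _ _ _
        _ ≤ 2 := by linarith [hy.2.1]
    exact ⟨hin y hy.1 hzy, hy.2.1, le_trans (card_contacts_le hsub y) hy.2.2⟩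
  calc ∑ y ∈ P', ((12 : ℝ) - ((X'.filter fun q => dist y q = 1).card : ℝ))
      ≤ ∑ y ∈ P', ((12 : ℝ) - ((X.filter fun q => dist y q = 1).card : ℝ)) := by
        refine sum_le_sum fun y _ => ?_
        have : ((X.filter fun q => dist y q = 1).card : ℝ) ≤ ((X'.filter fun q => dist y q = 1).card : ℝ) := by
          exact_mod_cast card_contacts_le hsub y
        linarith
    _ ≤ ∑ y ∈ P, ((12 : ℝ) - ((X.filter fun q => dist y q = 1).card : ℝ)) := by
        refine sum_le_sum_of_subset_of_nonneg hPP fun y hy _ => ?_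
        rw [hP, mem_filter] at hy
        have : ((X.filter fun q => dist y q = 1).card : ℝ) ≤ 11 := by exact_mod_cast hy.2.2
        linarith

open scoped Classical in
/-- **Pooled deficiency with activation**: if `b` (within `1` of `z`) has two payers in `X` but not in `X'`, then
`pooledDef X' b + 1 ≤ pooledDef X b`. -/
theorem pooledDef_add_one_le_of_activation (hsub : X ⊆ X') (hin : ∀ x ∈ X', dist z x ≤ 2 → x ∈ X)
    {b : EuclideanSpace ℝ (Fin 3)} (hb : dist z b ≤ 1) (hX : HasTwoPayers X b) (hX' : ¬ HasTwoPayers X' b) :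
    pooledDef X' b + 1 ≤ pooledDef X b := by
  -- a neighbour `y₀` of `b` deficient in `X` but saturated in `X'`
  obtain ⟨y₀, hy₀X, hby₀, hdef, hsat⟩ : ∃ y₀ ∈ X, dist b y₀ = 1 ∧ (X.filter fun q => dist y₀ q = 1).card ≤ 11 ∧
      ¬ (X'.filter fun q => dist y₀ q = 1).card ≤ 11 := by
    unfold HasTwoPayers at hX hX'
    have hdeg' : ¬ (X'.filter fun q => dist b q = 1).card ≤ 11 := fun h => hX' (Or.inl h)
    rcases hX with hdeg | ⟨z₁, hz₁, z₂, hz₂, hne, hd₁, hd₂, hc₁, hc₂⟩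
    · rw [card_contacts_eq hsub hin hb] at hdeg
      exact absurd hdeg hdeg'
    · by_cases h₁ : (X'.filter fun q => dist z₁ q = 1).card ≤ 11
      · by_cases h₂ : (X'.filter fun q => dist z₂ q = 1).card ≤ 11
        · exact absurd (Or.inr ⟨z₁, hsub hz₁, z₂, hsub hz₂, hne, hd₁, hd₂, h₁, h₂⟩) hX'
        · exact ⟨z₂, hz₂, hd₂, hc₂, h₂⟩
      · exact ⟨z₁, hz₁, hd₁, hc₁, h₁⟩
  unfold pooledDef
  set P := X.filter (fun y => dist b y ≤ 1 ∧ (X.filter fun q => dist y q = 1).card ≤ 11) with hP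
  set P' := X'.filter (fun y => dist b y ≤ 1 ∧ (X'.filter fun q => dist y q = 1).card ≤ 11) with hP'
  have hPP : P' ⊆ P := by
    intro y hy
    rw [hP', mem_filter] at hy
    rw [hP, mem_filter]
    have hzy : dist z y ≤ 2 := by
      calc dist z y ≤ dist z b + dist b y := dist_triangle _ _ _
        _ ≤ 2 := by linarith [hy.2.1]
    exact ⟨hin y hy.1 hzy, hy.2.1, le_trans (card_contacts_le hsub y) hy.2.2⟩
  have hy₀P : y₀ ∈ P := by rw [hP, mem_filter]; exact ⟨hy₀X, hby₀.le, hdef⟩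
  have hy₀P' : y₀ ∉ P' := by rw [hP', mem_filter]; exact fun h => hsat h.2.2
  have hins : insert y₀ P' ⊆ P := insert_subset hy₀P hPP
  have hnonneg : ∀ y ∈ P, (0 : ℝ) ≤ (12 : ℝ) - ((X.filter fun q => dist y q = 1).card : ℝ) := by
    intro y hy
    rw [hP, mem_filter] at hy
    have : ((X.filter fun q => dist y q = 1).card : ℝ) ≤ 11 := by exact_mod_cast hy.2.2
    linarith
  have hy₀one : (1 : ℝ) ≤ (12 : ℝ) - ((X.filter fun q => dist y₀ q = 1).card : ℝ) := by
    have : ((X.filter fun q => dist y₀ q = 1).card : ℝ) ≤ 11 := by exact_mod_cast hdef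
    linarith
  calc ∑ y ∈ P', ((12 : ℝ) - ((X'.filter fun q => dist y q = 1).card : ℝ)) + 1
      ≤ ∑ y ∈ P', ((12 : ℝ) - ((X.filter fun q => dist y q = 1).card : ℝ))
          + ((12 : ℝ) - ((X.filter fun q => dist y₀ q = 1).card : ℝ)) := by
        refine add_le_add (sum_le_sum fun y _ => ?_) hy₀one
        have : ((X.filter fun q => dist y q = 1).card : ℝ) ≤ ((X'.filter fun q => dist y q = 1).card : ℝ) := by
          exact_mod_cast card_contacts_le hsub y
        linarith
    _ = ∑ y ∈ insert y₀ P', ((12 : ℝ) - ((X.filter fun q => dist y q = 1).card : ℝ)) := by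
        rw [sum_insert hy₀P', add_comm]
    _ ≤ ∑ y ∈ P, ((12 : ℝ) - ((X.filter fun q => dist y q = 1).card : ℝ)) :=
        sum_le_sum_of_subset_of_nonneg hins fun y hy _ => hnonneg y hy

open scoped Classical in
/-- **Pooled deficiency, flat form**: if `b` (within `1` of `z`) has two payers in `X`, then
`pooledDefFlat X' b ≤ pooledDef X b`. -/
theorem pooledDefFlat_le_pooledDef (hsub : X ⊆ X') (hin : ∀ x ∈ X', dist z x ≤ 2 → x ∈ X)
    {b : EuclideanSpace ℝ (Fin 3)} (hb : dist z b ≤ 1) (hX : HasTwoPayers X b) :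
    pooledDefFlat X' b ≤ pooledDef X b := by
  unfold pooledDefFlat
  split_ifs with h
  · rw [add_zero]; exact pooledDef_le_of_outer hsub hin hb
  · exact pooledDef_add_one_le_of_activation hsub hin hb hX h

open scoped Classical in
/-- The flat pooled deficiency near the payer `z` is at least `1` (the payer itself pays). -/
theorem one_le_pooledDefFlat (hsub : X ⊆ X') (hin : ∀ x ∈ X', dist z x ≤ 2 → x ∈ X) (hz : z ∈ X)
    (hzdeg : (X.filter fun q => dist z q = 1).card ≤ 11) {b : EuclideanSpace ℝ (Fin 3)} (hb : dist z b ≤ 1) :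
    1 ≤ pooledDefFlat X' b := by
  have hzdeg' : (X'.filter fun q => dist z q = 1).card ≤ 11 := by
    rwa [← card_contacts_eq hsub hin (show dist z z ≤ 1 by simp)]
  have hnn : ∀ y ∈ X'.filter (fun y => dist b y ≤ 1 ∧ (X'.filter fun q => dist y q = 1).card ≤ 11),
      (0 : ℝ) ≤ (12 : ℝ) - ((X'.filter fun q => dist y q = 1).card : ℝ) := by
    intro y hy
    rw [mem_filter] at hy
    have : ((X'.filter fun q => dist y q = 1).card : ℝ) ≤ 11 := by exact_mod_cast hy.2.2
    linarith
  have hzmem : z ∈ X'.filter (fun y => dist b y ≤ 1 ∧ (X'.filter fun q => dist y q = 1).card ≤ 11) := by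
    rw [mem_filter]; exact ⟨hsub hz, by rwa [dist_comm], hzdeg'⟩
  have h1 : (1 : ℝ) ≤ (12 : ℝ) - ((X'.filter fun q => dist z q = 1).card : ℝ) := by
    have : ((X'.filter fun q => dist z q = 1).card : ℝ) ≤ 11 := by exact_mod_cast hzdeg'
    linarith
  have hpd : (1 : ℝ) ≤ pooledDef X' b := by
    unfold pooledDef
    exact le_trans h1 (single_le_sum hnn hzmem)
  unfold pooledDefFlat
  split_ifs <;> linarith

open scoped Classical in
/-- **THE OUTER-SHELL REDUCTION.**  Let `X ⊆ X'` agree inside the closed ball `B̄(z, 2)` about a payer `z` of `X`, and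
let the added balls `X' ∖ X` avoid the far slots of every twin reading of `X` at a ball within `2` of `z`.  Then the
(A)-summand of `X` at `z` is at most the FLAT summand of `X'` at `z` (two-payer clause dropped from the multiplicity,
one unit of deficiency charged per activation), for any two plate systems with slot roots. -/
theorem localSummandA_le_localSummandFlat (h₁ : S₁.RT ⊆ fccSlots) (h₂ : S₂.RT ⊆ fccSlots) (hsub : X ⊆ X')
    (hin : ∀ x ∈ X', dist z x ≤ 2 → x ∈ X) (hz : z ∈ X) (hzdeg : (X.filter fun q => dist z q = 1).card ≤ 11)
    (hfar : ∀ q ∈ X, dist z q ≤ 2 → ∀ (G : EuclideanSpace ℝ (Fin 3) ≃ₗᵢ[ℝ] EuclideanSpace ℝ (Fin 3)) (m),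
      IsTwinReading X G m q → ∀ w ∈ fccSlots, 0 < ⟪G w, m⟫_ℝ → q + G w ∉ X') :
    localSummandA v S₁ S₂ X z ≤ localSummandFlat v S₁ S₂ X' z := by
  unfold localSummandA localSummandFlat
  set B := X.filter (fun b => dist z b ≤ 1 ∧ 0 < endMultA X v S₁ S₂ b) with hB
  set B' := X'.filter (fun b => dist z b ≤ 1 ∧ 0 < endMultFlat X' v S₁ S₂ b) with hB'
  have hBB : B ⊆ B' := by
    intro b hb
    rw [hB, mem_filter] at hb
    rw [hB', mem_filter]
    exact ⟨hsub hb.1, hb.2.1, lt_of_lt_of_le hb.2.2 (endMultA_le_endMultFlat h₁ h₂ hsub hin hfar hb.2.1)⟩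
  calc ∑ b ∈ B, (endMultA X v S₁ S₂ b : ℝ) / pooledDef X b
      ≤ ∑ b ∈ B, (endMultFlat X' v S₁ S₂ b : ℝ) / pooledDefFlat X' b := by
        refine sum_le_sum fun b hb => ?_
        rw [hB, mem_filter] at hb
        obtain ⟨hbX, hbz, hpos⟩ := hb
        -- `b` has two payers in `X` (it has an end pair)
        have htp : HasTwoPayers X b := by
          unfold endMultA at hpos
          obtain ⟨q, hq⟩ := Finset.card_pos.1 hpos
          exact (mem_filter.1 hq).2.2.2.1
        refine div_le_div₀ (Nat.cast_nonneg _) ?_ ?_ ?_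
        · exact_mod_cast endMultA_le_endMultFlat h₁ h₂ hsub hin hfar hbz
        · linarith [one_le_pooledDefFlat hsub hin hz hzdeg hbz]
        · exact pooledDefFlat_le_pooledDef hsub hin hbz htp
    _ ≤ ∑ b ∈ B', (endMultFlat X' v S₁ S₂ b : ℝ) / pooledDefFlat X' b := by
        refine sum_le_sum_of_subset_of_nonneg hBB fun b hb _ => ?_
        rw [hB', mem_filter] at hb
        exact div_nonneg (Nat.cast_nonneg _) (by linarith [one_le_pooledDefFlat hsub hin hz hzdeg hb.2.1])

open scoped Classical in
/-- **THE OUTER-SHELL REDUCTION, union form.**  Adding to `X` any finite set `A` of balls beyond distance `2` from the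
payer `z` that avoids the far slots of the twin readings of `X` near `z` can only raise the summand, in its flat form:
`localSummandA v S₁ S₂ X z ≤ localSummandFlat v S₁ S₂ (X ∪ A) z`. -/
theorem localSummandA_le_localSummandFlat_union (h₁ : S₁.RT ⊆ fccSlots) (h₂ : S₂.RT ⊆ fccSlots)
    (A : Finset (EuclideanSpace ℝ (Fin 3))) (hA : ∀ a ∈ A, 2 < dist z a) (hz : z ∈ X)
    (hzdeg : (X.filter fun q => dist z q = 1).card ≤ 11)
    (hfarA : ∀ q ∈ X, dist z q ≤ 2 → ∀ (G : EuclideanSpace ℝ (Fin 3) ≃ₗᵢ[ℝ] EuclideanSpace ℝ (Fin 3)) (m),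
      IsTwinReading X G m q → ∀ w ∈ fccSlots, 0 < ⟪G w, m⟫_ℝ → q + G w ∉ A) :
    localSummandA v S₁ S₂ X z ≤ localSummandFlat v S₁ S₂ (X ∪ A) z := by
  refine localSummandA_le_localSummandFlat h₁ h₂ subset_union_left ?_ hz hzdeg ?_
  · intro x hx hxz
    rcases mem_union.1 hx with h | h
    · exact h
    · exact absurd hxz (not_le.2 (hA x h))
  · intro q hq hqz G m htw w hw hpos hmem
    rcases mem_union.1 hmem with h | h
    · exact htw.2.2.2 w hw hpos h
    · exact hfarA q hq hqz G m htw w hw hpos h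

end Reduction

end Summit.Ventures.Crystal3D.Theorems

end
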